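import Literature.IUT.HodgeArakelov.BadPrimeGaussianMonoidsGenuineRecordTorsionProofs
import Literature.IUT.HodgeArakelov.EtaleThetaDataOfSettingKummerTower
import Literature.IUT.HodgeArakelov.MonoThetaProjectiveBridgeEtTh
import Literature.IUT.HodgeArakelov.ThetaEvaluationModelEvTorsion
import Literature.IUT.HodgeArakelov.MonoThetaProjectiveThetaEnvProofs

/-!
# [IUTchII] Cor 3.5 (ii) / Cor 1.12 binder `htors` ("`M^μ_TM ⊆ M^×_TM`") AT THE GENUINE RECORD over `Π = Π^tp_X̲̲` with
# constants `ℚ̄_pˣ ⊇ O` through `ε`: the inputs `(c, hc)`, `hOtors` and `hlim` DISCHARGED — proof companion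

Proof-only companion (abc-iut cell, D-0067 wave 4, seat abc-iut-w4-d007 gen 4; layer L6; node **IUTchII:Cor3.5(ii)**, restriction-
ISO clause, binder `htors`; also the Cor 1.12 binder `hμ`) to abc-iut-w4-d004's
`BadPrimeGaussianMonoidsGenuineRecordTorsionProofs.lean` (p423317: `EtaleLevels.htors_thetaEnvRecordKummer` — for abc-iut-w4-d019's
GENUINE record `EtaleLevels.thetaEnvRecordKummer` every torsion element of the ambient module `lim_J H¹(Π^tp_{Ÿ̲̲} ∩ J, l·Δ_Θ)`
lies in `M^×_TM = κ(O)^×`, under the inputs `hc : Function.Bijective c.hom` (the cyclotomic rigidity ISOMORPHISM) and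
`hOtors` (the constant monoid `O` contains the roots of unity with their inverses)), to this seat's
`EtaleThetaDataOfSettingKummerTower.lean` (p422741: `exists_cyclotomeCoefficients_of_cyclotomeTower`; twins of the present file for
Prop 3.1 (ii) / Cor 1.12 (ii): p425448 / p425297), to abc-iut-w5-d205's
`ThetaEvaluationModelEvTorsion.lean` (`mem_unitGroup_padic_of_isOfFinOrder`: roots of unity of `ℚ̄_p` are units of the ring of
integers) and to abc-iut-w4-d030's `MonoThetaProjectiveThetaEnvProofs.lean` (`bijective_rigidLimHom`: the limit cyclotomic rigidity
map of the natural system is bijective — the record's family binder `hlim`).  No definitions; nothing of those files is restated.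

S. Mochizuki, *Inter-universal Teichmüller theory II*, kurims manuscript (Dec. 2020), Cor 1.12 (d) p. 56 ("`M^μ_TM(−) ⊆ M^×_TM(−)`
denotes the submodule of torsion elements"), Prop 3.1 (ii) p. 88, Cor 3.5 (ii) p. 95 [cite: Mochizuki2012, Prop 3.1 (ii) p.88];
[cite: MochizukiAbsTopIII2015, Definition 3.1 (i) p.66] (`𝒪^▷_{k̄} ⊇ 𝒪^×_{k̄} ⊇ μ(k̄)`); classical content: the torsion of
`lim_{k′} H¹(G_{k′}, Ẑ(1))` is `κ(μ(k̄))` [cite: NeukirchSchmidtWingberg2008, II §7].  Claim key `Mochizuki2012` (D-0012, DISPUTED);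
nothing here takes a side on [IUTchIII] Cor 3.12.

WHAT IS DISCHARGED.  At the constants `A := ℚ̄_pˣ = (PadicAlgCl p)ˣ` with the Galois action of `Π^tp_X̲̲` through `ε`
(`EtaleThetaDataOfSetting.unitsAction`, this seat p418848), for any submonoid `O ≤ ℚ̄_pˣ` CONTAINING THE ROOTS OF UNITY (print:
`O = 𝒪^▷_{F̄_v}`; also `𝒪^×`, all of `ℚ̄_pˣ`) and any `ι₀`:
* the coefficient datum `c` of `thetaEnvRecordKummer` and its bijectivity `hc` are the THEOREM
  `exists_cyclotomeCoefficients_of_cyclotomeTower` (on abc-iut-w4-d043's chain tower `EtaleLevels.cyclotomeTower mods hmods`; the `c`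
  so obtained is inverse to the model's own identifications: `(mods M).red (c ζ) = ζ_M`), given `hO : IsEtThOrigin` (F-2498) and
  `hΔ : IsCompact Δ_Θ` (GAP-LEDGER G-w5d187-1);
* `hOtors` reduces to "`O` contains every root of unity" (a root of unity's inverse is a root of unity) — a THEOREM for print's
  `O = 𝒪^▷_{ℚ̄_p}` and for `O = 𝒪^×_{ℚ̄_p}` (abc-iut-w5-d205's `mem_unitGroup_padic_of_isOfFinOrder`, abc-iut-L4's
  `unitSubmonoid_le_nonzeroIntegers`);
* the record's family binder `hlim` is abc-iut-w4-d030's theorem `bijective_rigidLimHom` (the `_rigid` forms).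
PROVED: `EtaleLevels.htors_thetaEnvRecordKummer_of_cyclotomeTower` (any `O ⊇ μ`, any `hlim`),
`…_of_cyclotomeTower_rigid` (`hlim := bijective_rigidLimHom`), `…_unitGroup_of_cyclotomeTower_rigid` (`O := 𝒪^×_{ℚ̄_p}`),
`…_nonzeroIntegers_of_cyclotomeTower_rigid` (`O := 𝒪^▷_{ℚ̄_p}`, print's constant monoid); bookkeeping
`unitGroup_le_comap_nonzeroIntegers_padic` (`𝒪^× ≤ 𝒪^▷` inside `ℚ̄_pˣ`), `mem_comap_nonzeroIntegers_padic_of_isOfFinOrder`.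
Residual NAMED inputs of the `htors`/`hμ` clause at the genuine record after this file: abc-iut-w4-d030/d043's model data
(`mods`/`hmods`/`h15`/`L`/`hZ`/`hcharY`, the natural projective system) + `IsEtThOrigin` + `IsCompact Δ_Θ` — nothing else.
Typed ≠ proved for those inputs; instantiated ≠ endorsed.
-/

noncomputable section

namespace Literature.IUT.HodgeArakelov

open Literature.AnabelianGeometry.EtaleTheta CohomologySystemOfContH1 EtaleThetaDataOfSetting
open Literature.AnabelianGeometry.AbsoluteAnabelian

/-! ### Print's constant monoid `𝒪^▷_{ℚ̄_p}` inside `ℚ̄_pˣ` contains the roots of unity (classical bookkeeping) -/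

/-- `𝒪^×_{ℚ̄_p} ≤ 𝒪^▷_{ℚ̄_p}` read inside `ℚ̄_pˣ`: abc-iut-L4's subgroup `unitGroup ℚ_[p] ℚ̄_p ≤ ℚ̄_pˣ` is contained in the
pull-back of abc-iut-L4's submonoid `nonzeroIntegers ℚ_[p] ℚ̄_p ≤ ℚ̄_p` ("the multiplicative monoid of non-zero elements of the
ring of integers") along `ℚ̄_pˣ → ℚ̄_p` (`unitSubmonoid_le_nonzeroIntegers`). [cite: MochizukiAbsTopIII2015, Definition 3.1 (i) p.66] -/
theorem unitGroup_le_comap_nonzeroIntegers_padic {p : ℕ} [Fact p.Prime] :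
    (unitGroup ℚ_[p] (PadicAlgCl p)).toSubmonoid ≤
      (nonzeroIntegers ℚ_[p] (PadicAlgCl p)).comap (Units.coeHom (PadicAlgCl p)) := fun u hu =>
  Submonoid.mem_comap.mpr (unitSubmonoid_le_nonzeroIntegers ((mem_unitGroup_iff u).mp hu))

/-- Every root of unity of `ℚ̄_pˣ` lies in print's constant monoid `𝒪^▷_{ℚ̄_p}` (pulled back to `ℚ̄_pˣ`): it is a unit of the
ring of integers (abc-iut-w5-d205's `mem_unitGroup_padic_of_isOfFinOrder`), and units are non-zero integers.
[cite: MochizukiAbsTopIII2015, Definition 3.1 (i) p.66] -/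
theorem mem_comap_nonzeroIntegers_padic_of_isOfFinOrder {p : ℕ} [Fact p.Prime] {u : (PadicAlgCl p)ˣ}
    (hu : IsOfFinOrder u) : u ∈ (nonzeroIntegers ℚ_[p] (PadicAlgCl p)).comap (Units.coeHom (PadicAlgCl p)) :=
  unitGroup_le_comap_nonzeroIntegers_padic (mem_unitGroup_padic_of_isOfFinOrder hu)

namespace EtaleLevels

variable {p : ℕ} [Fact p.Prime] {D : Literature.AnabelianGeometry.EtaleTheta.ThetaSetting p}
  {E : D.EtaleThetaData} {l : ℕ} (C : E.DoubleUnderline l) (hC : D.Compat) (hS : D.Sec2Hyps)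
  (hl : l.Prime) (hp2 : p ≠ 2) (hpl : p ≠ l) (hζ : ∃ ζ : D.K, IsPrimitiveRoot ζ (4 * l))
  (mods : ∀ M : ℕ+, D.CyclotomeMod l M)
  (f : contCocycles D.toTheta D.DeltaTheta C.GtpYdduu) (hf : f ∈ C.rootCocycles hC)
  (hmods : ∀ (M M' : ℕ+) (h : (M : ℕ) ∣ (M' : ℕ)) (x : D.lDeltaTheta l),
    MuN.red p M M' h ((mods M').red x) = (mods M).red x)
  (h15 : Literature.AnabelianGeometry.EtaleTheta.ThetaSetting.Prop15iii E hC) (L : C.CuspLabels)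
  (hZ : ∀ M : ℕ+, Nonempty (ModelCyclotomes.lDeltaQuot (C.rigidData (mods M) hC hS h15 L) ≃*
    Literature.IUT.HodgeTheaters.ZHat))
  (hcharY : EtaleThetaDataOfSetting.PiYddCharacteristic C)
  (hlim : Function.Bijective (rigidLimHom C hC hS hl hp2 hpl hζ mods f hf hmods h15 L hZ))
  [(EtaleThetaDataOfSetting.PiYdd C).Normal]
  (O : Submonoid (PadicAlgCl p)ˣ) (hOμ : ∀ a : (PadicAlgCl p)ˣ, IsOfFinOrder a → a ∈ O) (ι₀ : Pi C)

/-! ### `htors` at the genuine record, `(c, hc)` and `hOtors` discharged -/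

include hOμ in
/-- **`M^μ_TM ⊆ M^×_TM` AT THE GENUINE RECORD, constants `ℚ̄_pˣ ⊇ O ⊇ μ` through `ε`, with `(c, hc)` and `hOtors` DISCHARGED.**
Given the origin guard `hO` and compactness of `Δ_Θ`, there is a BIJECTIVE change of coefficient cyclotome
`c : Λ(ℚ̄_pˣ) = Ẑ(1) ⥲ l·Δ_Θ`, inverse to the model's identifications (`(mods M).red (c ζ) = ζ_M` for all `M`), such that for
abc-iut-w4-d019's genuine record `thetaEnvRecordKummer … c (isOpen_stabilizer_units C) (finiteIndex_stabilizer_units C) O ι₀`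
(`Ψ_cns := κ(O)`) EVERY TORSION ELEMENT of the ambient module `lim_J H¹(Π^tp_{Ÿ̲̲} ∩ J, l·Δ_Θ)` lies in the unit group `M^×_TM` —
abc-iut-w4-d004's `htors_thetaEnvRecordKummer` with `hc` from `exists_cyclotomeCoefficients_of_cyclotomeTower` and `hOtors` from
"`O` contains the roots of unity" (their inverses being roots of unity).  The binder `htors` of the Cor 3.5 (ii) family / `hμ` of
Cor 1.12 at the genuine record, modulo the model data + `IsEtThOrigin` + `IsCompact Δ_Θ` only.
[claim: Mochizuki2012, status: disputed] (IUTchII §3 Cor 3.5 (ii), kurims p.95) -/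
theorem htors_thetaEnvRecordKummer_of_cyclotomeTower (hO : D.IsEtThOrigin)
    (hΔ : IsCompact (D.DeltaTheta : Set D.GtpTheta)) :
    ∃ c : CyclotomeCoefficients (phi C) (D.lDeltaTheta l) (PadicAlgCl p)ˣ,
      Function.Bijective c.hom ∧
      (∀ (ζ : Literature.AnabelianGeometry.EtaleTheta.cyclotome (PadicAlgCl p)ˣ) (M : ℕ+),
        (((mods M).red (c.hom ζ) : MuN p M) : (PadicAlgCl p)ˣ) = (ζ : ℕ+ → (PadicAlgCl p)ˣ) M) ∧
      ∀ x : (thetaEnvRecordKummer C hC hS hl hp2 hpl hζ mods f hf hmods h15 L hZ hcharY hlim c (isOpen_stabilizer_units C)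
          (finiteIndex_stabilizer_units C) O ι₀).H,
        IsOfFinOrder x →
          x ∈ (thetaEnvRecordKummer C hC hS hl hp2 hpl hζ mods f hf hmods h15 L hZ hcharY hlim c (isOpen_stabilizer_units C)
            (finiteIndex_stabilizer_units C) O ι₀).units := by
  -- the coefficient iso from the chain tower of the model's identifications
  obtain ⟨c, hc, hlev⟩ := exists_cyclotomeCoefficients_of_cyclotomeTower C hO hΔ
    (cyclotomeTower mods hmods (dvd_refl ((1 : ℕ+) : ℕ)))
  refine ⟨c, hc, fun ζ M => ?_, ?_⟩
  · -- the chain tower's all-level identification at `M` is `mods M` (compatibility `hmods`)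
    have hmod : ((cyclotomeTower mods hmods (dvd_refl ((1 : ℕ+) : ℕ))).modAll M).red (c.hom ζ) =
        (mods M).red (c.hom ζ) := by
      rw [ThetaSetting.CyclotomeTower.modAll_red, ThetaSetting.CyclotomeTower.redVia_apply]
      exact hmods M _ _ (c.hom ζ)
    rw [← hmod]
    exact hlev ζ M
  · -- `hOtors`: a root of unity and its inverse (again a root of unity) lie in `O`
    exact htors_thetaEnvRecordKummer C hC hS hl hp2 hpl hζ mods f hf hmods h15 L hZ hcharY hlim c
      (isOpen_stabilizer_units C) (finiteIndex_stabilizer_units C) O ι₀ hc fun a ha => ⟨hOμ a ha, hOμ a⁻¹ ha.inv⟩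

include hOμ in
/-- **The same with the family binder `hlim` supplied by abc-iut-w4-d030's theorem `bijective_rigidLimHom`**: `M^μ_TM ⊆ M^×_TM` at
the genuine record `thetaEnvRecordKummer … (bijective_rigidLimHom …) c … O ι₀`, `(c, hc)`/`hOtors`/`hlim` all discharged; residual =
the model data + `IsEtThOrigin` + `IsCompact Δ_Θ`. [claim: Mochizuki2012, status: disputed] (IUTchII §3 Cor 3.5 (ii), kurims p.95) -/
theorem htors_thetaEnvRecordKummer_of_cyclotomeTower_rigid (hO : D.IsEtThOrigin)
    (hΔ : IsCompact (D.DeltaTheta : Set D.GtpTheta)) :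
    ∃ c : CyclotomeCoefficients (phi C) (D.lDeltaTheta l) (PadicAlgCl p)ˣ,
      Function.Bijective c.hom ∧
      (∀ (ζ : Literature.AnabelianGeometry.EtaleTheta.cyclotome (PadicAlgCl p)ˣ) (M : ℕ+),
        (((mods M).red (c.hom ζ) : MuN p M) : (PadicAlgCl p)ˣ) = (ζ : ℕ+ → (PadicAlgCl p)ˣ) M) ∧
      ∀ x : (thetaEnvRecordKummer C hC hS hl hp2 hpl hζ mods f hf hmods h15 L hZ hcharY
          (bijective_rigidLimHom C hC hS hl hp2 hpl hζ mods f hf hmods h15 L hZ) c (isOpen_stabilizer_units C)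
          (finiteIndex_stabilizer_units C) O ι₀).H,
        IsOfFinOrder x →
          x ∈ (thetaEnvRecordKummer C hC hS hl hp2 hpl hζ mods f hf hmods h15 L hZ hcharY
            (bijective_rigidLimHom C hC hS hl hp2 hpl hζ mods f hf hmods h15 L hZ) c (isOpen_stabilizer_units C)
            (finiteIndex_stabilizer_units C) O ι₀).units :=
  htors_thetaEnvRecordKummer_of_cyclotomeTower C hC hS hl hp2 hpl hζ mods f hf hmods h15 L hZ hcharY
    (bijective_rigidLimHom C hC hS hl hp2 hpl hζ mods f hf hmods h15 L hZ) O hOμ ι₀ hO hΔ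

/-- **`O := 𝒪^×_{ℚ̄_p}`** (abc-iut-L4's `unitGroup ℚ_[p] ℚ̄_p`, [AbsTopIII] Def 3.1 (i)): `M^μ_TM ⊆ M^×_TM` at the genuine record
with constant monoid `𝒪^×_{ℚ̄_p}`, `(c, hc)`/`hOtors`/`hlim` all discharged (`hOtors` = roots of unity are units of the ring of
integers, abc-iut-w5-d205). [claim: Mochizuki2012, status: disputed] (IUTchII §3 Cor 3.5 (ii), kurims p.95) -/
theorem htors_thetaEnvRecordKummer_unitGroup_of_cyclotomeTower_rigid (hO : D.IsEtThOrigin)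
    (hΔ : IsCompact (D.DeltaTheta : Set D.GtpTheta)) :
    ∃ c : CyclotomeCoefficients (phi C) (D.lDeltaTheta l) (PadicAlgCl p)ˣ,
      Function.Bijective c.hom ∧
      (∀ (ζ : Literature.AnabelianGeometry.EtaleTheta.cyclotome (PadicAlgCl p)ˣ) (M : ℕ+),
        (((mods M).red (c.hom ζ) : MuN p M) : (PadicAlgCl p)ˣ) = (ζ : ℕ+ → (PadicAlgCl p)ˣ) M) ∧
      ∀ x : (thetaEnvRecordKummer C hC hS hl hp2 hpl hζ mods f hf hmods h15 L hZ hcharY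
          (bijective_rigidLimHom C hC hS hl hp2 hpl hζ mods f hf hmods h15 L hZ) c (isOpen_stabilizer_units C)
          (finiteIndex_stabilizer_units C) (unitGroup ℚ_[p] (PadicAlgCl p)).toSubmonoid ι₀).H,
        IsOfFinOrder x →
          x ∈ (thetaEnvRecordKummer C hC hS hl hp2 hpl hζ mods f hf hmods h15 L hZ hcharY
            (bijective_rigidLimHom C hC hS hl hp2 hpl hζ mods f hf hmods h15 L hZ) c (isOpen_stabilizer_units C)
            (finiteIndex_stabilizer_units C) (unitGroup ℚ_[p] (PadicAlgCl p)).toSubmonoid ι₀).units :=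
  htors_thetaEnvRecordKummer_of_cyclotomeTower_rigid C hC hS hl hp2 hpl hζ mods f hf hmods h15 L hZ hcharY
    (unitGroup ℚ_[p] (PadicAlgCl p)).toSubmonoid (fun _ ha => mem_unitGroup_padic_of_isOfFinOrder ha) ι₀ hO hΔ

/-- **`O := 𝒪^▷_{ℚ̄_p}`, PRINT'S CONSTANT MONOID** ("`Ψ_cns … ≅ O^▷_{F̄_v}`", Prop 3.1 (ii) p. 88; abc-iut-L4's
`nonzeroIntegers ℚ_[p] ℚ̄_p` pulled back to `ℚ̄_pˣ`): `M^μ_TM ⊆ M^×_TM` at the genuine record with constant monoid `𝒪^▷_{ℚ̄_p}`,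
`(c, hc)`/`hOtors`/`hlim` all discharged. [claim: Mochizuki2012, status: disputed] (IUTchII §3 Cor 3.5 (ii), kurims p.95) -/
theorem htors_thetaEnvRecordKummer_nonzeroIntegers_of_cyclotomeTower_rigid (hO : D.IsEtThOrigin)
    (hΔ : IsCompact (D.DeltaTheta : Set D.GtpTheta)) :
    ∃ c : CyclotomeCoefficients (phi C) (D.lDeltaTheta l) (PadicAlgCl p)ˣ,
      Function.Bijective c.hom ∧
      (∀ (ζ : Literature.AnabelianGeometry.EtaleTheta.cyclotome (PadicAlgCl p)ˣ) (M : ℕ+),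
        (((mods M).red (c.hom ζ) : MuN p M) : (PadicAlgCl p)ˣ) = (ζ : ℕ+ → (PadicAlgCl p)ˣ) M) ∧
      ∀ x : (thetaEnvRecordKummer C hC hS hl hp2 hpl hζ mods f hf hmods h15 L hZ hcharY
          (bijective_rigidLimHom C hC hS hl hp2 hpl hζ mods f hf hmods h15 L hZ) c (isOpen_stabilizer_units C)
          (finiteIndex_stabilizer_units C) ((nonzeroIntegers ℚ_[p] (PadicAlgCl p)).comap (Units.coeHom (PadicAlgCl p))) ι₀).H,
        IsOfFinOrder x →
          x ∈ (thetaEnvRecordKummer C hC hS hl hp2 hpl hζ mods f hf hmods h15 L hZ hcharY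
            (bijective_rigidLimHom C hC hS hl hp2 hpl hζ mods f hf hmods h15 L hZ) c (isOpen_stabilizer_units C)
            (finiteIndex_stabilizer_units C) ((nonzeroIntegers ℚ_[p] (PadicAlgCl p)).comap (Units.coeHom (PadicAlgCl p)))
            ι₀).units :=
  htors_thetaEnvRecordKummer_of_cyclotomeTower_rigid C hC hS hl hp2 hpl hζ mods f hf hmods h15 L hZ hcharY
    ((nonzeroIntegers ℚ_[p] (PadicAlgCl p)).comap (Units.coeHom (PadicAlgCl p)))
    (fun _ ha => mem_comap_nonzeroIntegers_padic_of_isOfFinOrder ha) ι₀ hO hΔ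

end EtaleLevels

end Literature.IUT.HodgeArakelov

end
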